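import Summits.FinalStateConjecture.FinalStateConjecture.Theorems.BartnikGapSettlingBondiBartnikRigidityStationaryKerrCollarRouteOriented
import Literature.Geometry.Lorentzian.KerrData
import HarnessLib

/-!
# The MARCHING route to the corrected F5 — line `direct-method-on-the-cone` (crux `BondiBartnikRigidity`,
# stmt-FinalStateConjecture-10807), wave-2 worker K2b, landed by lead a2

Typed statements (route-posited, `[conjecture]`; nothing asserted) of the honest route to the corrected F5
`K2Route.RoofDevelopmentExtensionCollar` by SPACELIKE MARCHING on the level sets of `t*` (K2b-report-a2 §4):
the two explicit Kerr facts shared with F6 (`SlabFutureContainsCylinder`, `SlabFrontier`), the soft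
past-set transfer and chart-gluing lemmas (`ExactChartPastSet`, `ExactChartGluing`), the `MarchingLemma`
itself (conditional on those and on `choquetBruhat_geroch_exists_mghd_cauchy` through the landed
hypersurface localisation engine), and the CHECKED reduction
`roofDevelopmentExtensionCollar_of_marching : MarchingLemma → RoofDevelopmentExtensionCollar` (closed form =
the registered sub-goal `stub_roofDevelopmentExtensionCollarOfMarching`); with the Kerr-side set bookkeeping it
uses (`isOpen_truncFutureK`, `truncFutureK_subset`, `exactOn_pullK_mono`, …; all proved).

References: Choquet-Bruhat–Geroch 1969, Thm 3 [ChoquetBruhatGeroch1969CMP]; Hawking–Ellis 1973, §6.3–§6.5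
[HawkingEllis1973CUP]; O'Neill 1983, Prop. 3.62, Lemma 14.29 [ONeill1983]; Sbierski 2016 §3 [Sbierski2016AHP];
Dafermos–Rodnianski 0811.0354 §5.1 [DafermosRodnianski2008].
-/

noncomputable section

-- D-0017: single-problem summit, `Summit.<S>.<S>.…` by design (cf. lakefile `weak.linter.dupNamespace`).
set_option linter.dupNamespace false
-- instance search through the nested operator types of the Kerr chart facts
set_option maxSynthPendingDepth 3

open Set Filter Function Topology TopologicalSpace
open Literature.Geometry.Lorentzian
open scoped Manifold ContDiff Topology ENNReal

namespace Summit.FinalStateConjecture.FinalStateConjecture.Theorems.BondiBartnikRigidity.DirectMethod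

namespace K2Route

/-! ### Bookkeeping of the Kerr-side sets (proved) -/

section KerrSideSets

variable [Kerr.Facts]

omit [Kerr.Facts] in
/-- The `t*`-coordinate is continuous on the Kerr chart domain. -/
theorem continuous_tstar (a r₀ : ℝ) : Continuous fun y : Kerr.region a r₀ => y.1 0 :=
  (PiLp.continuous_apply 2 (fun _ : Fin 4 => ℝ) 0).comp continuous_subtype_val

omit [Kerr.Facts] in
/-- The Kerr–Schild radius is continuous on the Kerr chart domain. -/
theorem continuous_radius_region (a r₀ : ℝ) : Continuous fun y : Kerr.region a r₀ => Kerr.radius a y.1 :=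
  (Kerr.continuous_radius a).comp continuous_subtype_val

/-- **`truncFutureK` is open** (interior ∩ two open sublevel conditions). -/
theorem isOpen_truncFutureK (M a : ℝ) (hM : 0 < M) (ρ T₀ : ℝ) : IsOpen (truncFutureK M a hM ρ T₀) :=
  isOpen_interior.inter
    ((isOpen_lt (continuous_tstar a M) continuous_const).inter
      (isOpen_lt (continuous_radius_region a M) continuous_const))

/-- `truncFutureK` is monotone in `(ρ, T₀)`. -/
theorem truncFutureK_mono (M a : ℝ) (hM : 0 < M) {ρ ρ' T₀ T₀' : ℝ} (hρ : ρ ≤ ρ') (hT : T₀ ≤ T₀') :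
    truncFutureK M a hM ρ T₀ ⊆ truncFutureK M a hM ρ' T₀' :=
  fun _ h ↦ ⟨h.1, h.2.1.trans_le hT, h.2.2.trans_le hρ⟩

/-- `truncFutureK ρ T₀ ⊆ J⁺_K(slab)° ∩ {t* < T₀}` (drop the radius truncation). -/
theorem truncFutureK_subset (M a : ℝ) (hM : 0 < M) (ρ T₀ : ℝ) :
    truncFutureK M a hM ρ T₀ ⊆ interior (JK M a hM (slabK M a)) ∩ {y | y.1 0 < T₀} :=
  fun _ h ↦ ⟨h.1, h.2.1⟩

/-- `J⁺_K(slab)° ∩ {t* < T₀}` is open. -/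
theorem isOpen_interior_JK_inter_lt (M a : ℝ) (hM : 0 < M) (T₀ : ℝ) :
    IsOpen (interior (JK M a hM (slabK M a)) ∩ {y | y.1 0 < T₀}) :=
  isOpen_interior.inter (isOpen_lt (continuous_tstar a M) continuous_const)

omit [Kerr.Facts] in
/-- The identification `x ↦ Λ⁻¹(x − c)` of the star-background domain with the Kerr chart domain
is continuous. -/
theorem continuous_toKerr (mo : lorentzGroup × E4) (M a : ℝ) (r : E4 → ℝ) :
    Continuous fun x : (starBackground mo.1 mo.2 M a r).domain =>
      (⟨poincareInv mo.1 mo.2 x.1, x.2⟩ : Kerr.region a M) :=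
  ((continuous_poincareInv mo.1 mo.2).comp continuous_subtype_val).subtype_mk _

omit [Kerr.Facts] in
/-- For the star background, `pullK` is the preimage under the identification map. -/
theorem pullK_starBackground (mo : lorentzGroup × E4) (M a : ℝ) (r : E4 → ℝ)
    (S : Set (Kerr.region a M)) :
    pullK mo M a (starBackground mo.1 mo.2 M a r) S =
      (fun x : (starBackground mo.1 mo.2 M a r).domain =>
        (⟨poincareInv mo.1 mo.2 x.1, x.2⟩ : Kerr.region a M)) ⁻¹' S := by
  ext x
  exact ⟨fun ⟨_, h⟩ => h, fun h => ⟨x.2, h⟩⟩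

omit [Kerr.Facts] in
/-- **The pull-back of an OPEN Kerr-side set is open** in the domain of the collar background. -/
theorem isOpen_pullK_of_eq {mo : lorentzGroup × E4} {M a : ℝ} {B : ModelBackground}
    (hB : B = starBackground mo.1 mo.2 M a (fun x => Kerr.radius a (poincareInv mo.1 mo.2 x)))
    {S : Set (Kerr.region a M)} (hS : IsOpen S) : IsOpen (pullK mo M a B S) := by
  subst hB
  rw [pullK_starBackground]
  exact hS.preimage (continuous_toKerr mo M a _)

omit [Kerr.Facts] in
/-- … and its image in `E4` is open (the openness side condition of `isNearModelBox_of_exactOn` /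
`IsNearModelBox.of_exact_order_zero` for pulled-back Kerr-side regions). -/
theorem isOpen_image_val_pullK_of_eq {mo : lorentzGroup × E4} {M a : ℝ} {B : ModelBackground}
    (hB : B = starBackground mo.1 mo.2 M a (fun x => Kerr.radius a (poincareInv mo.1 mo.2 x)))
    {S : Set (Kerr.region a M)} (hS : IsOpen S) : IsOpen (Subtype.val '' pullK mo M a B S) :=
  B.domain.isOpen.isOpenMap_subtype_val _ (isOpen_pullK_of_eq hB hS)

omit [Kerr.Facts] in
/-- `pullK` commutes with intersections. -/
theorem pullK_inter (mo : lorentzGroup × E4) (M a : ℝ) (B : ModelBackground)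
    (S T : Set (Kerr.region a M)) : pullK mo M a B (S ∩ T) = pullK mo M a B S ∩ pullK mo M a B T := by
  ext x
  exact ⟨fun ⟨h, hS, hT⟩ => ⟨⟨h, hS⟩, ⟨h, hT⟩⟩, fun ⟨⟨h, hS⟩, ⟨_, hT⟩⟩ => ⟨h, hS, hT⟩⟩

omit [Kerr.Facts] in
/-- `pullK` commutes with unions. -/
theorem pullK_union (mo : lorentzGroup × E4) (M a : ℝ) (B : ModelBackground)
    (S T : Set (Kerr.region a M)) : pullK mo M a B (S ∪ T) = pullK mo M a B S ∪ pullK mo M a B T := by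
  ext x
  constructor
  · rintro ⟨h, hS | hT⟩
    exacts [Or.inl ⟨h, hS⟩, Or.inr ⟨h, hT⟩]
  · rintro (⟨h, hS⟩ | ⟨h, hT⟩)
    exacts [⟨h, Or.inl hS⟩, ⟨h, Or.inr hT⟩]

omit [Kerr.Facts] in
/-- **Restriction of an exact chart to an open Kerr-side sub-region.**  If `Ψ` is smooth on
`pullK Q`, an open embedding of it, maps it into `J` with vanishing deviation, and `S ⊆ Q` is
open on the Kerr side, then the same four clauses hold on `pullK S` (the restriction step of the
reduction `MarchingLemma → F5`). -/
theorem exactOn_pullK_mono {𝒮 : Spacetime.{0} 4} {mo : lorentzGroup × E4} {M a : ℝ} {B : ModelBackground}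
    (hB : B = starBackground mo.1 mo.2 M a (fun x => Kerr.radius a (poincareInv mo.1 mo.2 x)))
    {Q S : Set (Kerr.region a M)} {J : Set 𝒮.carrier} {Ψ : B.domain → 𝒮.carrier}
    (hs : ContMDiffOn 𝓘(ℝ, E4) (𝓡 4) ∞ Ψ (pullK mo M a B Q))
    (he : IsOpenEmbedding ((pullK mo M a B Q).restrict Ψ))
    (hJ : Ψ '' pullK mo M a B Q ⊆ J)
    (hd : supCkENorm (Subtype.val '' pullK mo M a B Q) 0 (𝒮.deviationExtend B Ψ) ≤ 0)
    (hSQ : S ⊆ Q) (hS : IsOpen S) :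
    ContMDiffOn 𝓘(ℝ, E4) (𝓡 4) ∞ Ψ (pullK mo M a B S) ∧
      IsOpenEmbedding ((pullK mo M a B S).restrict Ψ) ∧
      Ψ '' pullK mo M a B S ⊆ J ∧
      supCkENorm (Subtype.val '' pullK mo M a B S) 0 (𝒮.deviationExtend B Ψ) ≤ 0 := by
  have hsub : pullK mo M a B S ⊆ pullK mo M a B Q := pullK_mono _ _ _ _ hSQ
  refine ⟨hs.mono hsub, ?_, (image_mono hsub).trans hJ, (supCkENorm_mono (image_mono hsub) 0 _).trans hd⟩
  have hincl : IsOpenEmbedding (Set.inclusion hsub) :=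
    .inclusion hsub (continuous_subtype_val.isOpen_preimage _ (isOpen_pullK_of_eq hB hS))
  exact he.comp hincl

end KerrSideSets

/-! ### §4 The marching route for the corrected F5: signatures and the checked reduction -/

section Marching

/-- Kerr-side causal past `J⁻_K` of the star spacetime `Kerr.spacetime M a M`. -/
def JKpast [Kerr.Facts] (M a : ℝ) (hM : 0 < M) (S : Set (Kerr.region a M)) : Set (Kerr.region a M) :=
  (Kerr.spacetime M a M hM.le).metric.causalPast (Kerr.spacetime M a M hM.le).timeOrientation S

/-- **Shared Kerr fact 1 (with K2c / F6): the causal future of the slab contains the solid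
cylinder over it**, `J⁺_K(slab) ⊇ {t* ≥ 0, M < r ≤ 3M}` (`0 < M`, `|a| < M`).  Paper proof: from
`(t*, r)` with `M < r ≤ r₊` follow the outgoing principal null ray to the PAST (inside `r < r₊`
the radius increases pastward towards `r₊`, `t* → −∞`), from `r₊ < r ≤ 3M` the same ray (radius
decreasing pastward towards `r₊`); both cross `{t* = 0}` inside the slab.  Consequences used by
the marching: `J⁺_K(slab)° + s e₀ ⊆ J⁺_K(slab)°` for `s ≥ 0` (with the `t*`-translation isometry,
`KerrSchildTimeTranslation`), and `W ∩ {t* ≤ h} ⊆ Δ½ ∪ N_{2h}(roofK)`.  MISSING (explicit Kerr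
curves; closable). (ref: DafermosRodnianski2008, §5.1) (ref: ONeill1995, Ch. 4)
Route-posited statement; nothing is asserted. [conjecture] [folklore] -/
def SlabFutureContainsCylinder : Prop :=
  ∀ [Kerr.Facts] (M a : ℝ) (hM : 0 < M), |a| < M →
    {y : Kerr.region a M | 0 ≤ y.1 0 ∧ Kerr.radius a y.1 ≤ 3 * M} ⊆ JK M a hM (slabK M a)

/-- **Shared Kerr fact 2 (with K2c): the frontier of `J⁺_K(slab)` off the slab is ruled from the
outer edge sphere**, `∂J⁺_K(slab) ⊆ slab ∪ J⁺_K(S₃)` — so that `∂(J⁺_K(slab)°) ⊆ slabK ∪ roofK`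
(no "inner sheet" inside `{r > M}`: points `(t* > 0, r ↓ M)` are interior by fact 1).  Paper
proof: a frontier point `x ∉ slab` lies on a null geodesic from the slab without interior slab
points to its past (those would put `x` in `I⁺(slab)`), hence from the edge `S₃` (the inner edge
`{r = M}` is not in the chart).  MISSING (achronal-boundary structure of `∂J⁺` in the star chart;
closable from `CausalityBoundary.lean`). (ref: HawkingEllis1973CUP, §6.3, Prop. 6.3.1)
Route-posited statement; nothing is asserted. [conjecture] [folklore] -/
def SlabFrontier : Prop :=
  ∀ [Kerr.Facts] (M a : ℝ) (hM : 0 < M), |a| < M →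
    frontier (JK M a hM (slabK M a)) ⊆ slabK M a ∪ JK M a hM (outerSphereK M a)

variable {X : Type} [TopologicalSpace X] [ChartedSpace E3 X] [IsManifold (𝓡 3) ∞ X]
  [ConnectedSpace X] {D : InitialDataSet (𝓡 3) X}

/-- **Past-set transfer lemma** (the causal bookkeeping step (C) of the marching; soft, no Kerr
computation beyond compactness of truncated pasts).  Let `P ⊆ W := J⁺_K(slab)°` be an OPEN
Kerr-side set which is PAST-CLOSED in `W` in the closed form (the closure of `J⁻_K(x)`, `x ∈ P`,
meets `W` inside `P`, meets `∂W` inside `slab ∪ (roofK ∩ {r ≤ ρ})`, and is compact), and `Ψ` an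
exact, time-orientation preserving chart on `pullK P` with image in `J⁺(C)`, continuous up to
`slab ∪ roof portion`, equal to `Φ₀` on the slab (`Φ₀(slab) ⊆ C ⊆ ι X`) and mapping the roof
portion into `∂J⁺(C)`.  Then `Ψ(pullK P)` is past-closed in `I⁺(C)`:
`J⁻_𝒱(Ψ x) ∩ I⁺_𝒱(C) ⊆ Ψ(pullK P)` for every `x ∈ pullK P`.  Paper proof: lift a past causal
curve of `𝒱` from `Ψ x` through the open embedding `Ψ`; the lift is a Kerr past causal curve in
`J⁻_K(x) ∩ W`; at a first exit parameter its limit point `z` exists (compactness) and lies in `P`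
(then no exit), on the slab (then the `𝒱`-curve reaches `ι X` from `I⁺(C) ⊆ I⁺(ι X)` —
chronology of the Cauchy hypersurface) or on the roof (then it reaches `∂J⁺(C)` from `I⁺(C)`,
which is a future set disjoint from `∂J⁺(C)`).  Consequences: `Ψ(P ∩ {t* = τ})` is ACAUSAL in `𝒱`
(pull back a causal chord), and glued charts are injective.  MISSING (formalisable now: curve
lifting through open embeddings `TimelikeCurveLift*`, push-up `CausalityPushUp`, achronality of
`range 𝒱.embed`). (ref: HawkingEllis1973CUP, §6.5) Route-posited statement; nothing is asserted.
[conjecture] [folklore] -/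
def ExactChartPastSet : Prop :=
  ∀ [Kerr.Facts] (X : Type) [TopologicalSpace X] [ChartedSpace E3 X] [IsManifold (𝓡 3) ∞ X]
    [T2Space X] [SecondCountableTopology X] [ConnectedSpace X]
    (D : InitialDataSet (𝓡 3) X) (𝒱 : VacuumCauchyDevelopment D)
    (M a : ℝ) (hM : 0 < M) (mo : lorentzGroup × E4) (B : ModelBackground)
    (Φ₀ Ψ : B.domain → 𝒱.carrier) (C : Set 𝒱.carrier) (P : Set (Kerr.region a M)) (ρ : ℝ),
    |a| < M →
    B = starBackground mo.1 mo.2 M a (fun x => Kerr.radius a (poincareInv mo.1 mo.2 x)) →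
    Φ₀ '' pullK mo M a B (slabK M a) ⊆ C → C ⊆ range 𝒱.embed →
    -- `P` open, inside `W`, past-closed in `W` (closed form), with compact truncated pasts
    IsOpen P → P ⊆ interior (JK M a hM (slabK M a)) →
    (∀ x ∈ P, closure (JKpast M a hM {x}) ∩ interior (JK M a hM (slabK M a)) ⊆ P) →
    (∀ x ∈ P, closure (JKpast M a hM {x}) ∩ frontier (JK M a hM (slabK M a)) ⊆
      slabK M a ∪ (roofK M a hM ∩ {y | Kerr.radius a y.1 ≤ ρ})) →
    (∀ x ∈ P, IsCompact (closure (JKpast M a hM {x}) ∩ closure (JK M a hM (slabK M a)))) →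
    -- `Ψ` exact, t.o.p., open embedding on `pullK P`, image in `J⁺(C)`
    ContMDiffOn 𝓘(ℝ, E4) (𝓡 4) ∞ Ψ (pullK mo M a B P) →
    IsOpenEmbedding ((pullK mo M a B P).restrict Ψ) →
    Ψ '' pullK mo M a B P ⊆ 𝒱.metric.causalFuture 𝒱.timeOrientation C →
    supCkENorm (Subtype.val '' pullK mo M a B P) 0 (𝒱.toSpacetime.deviationExtend B Ψ) ≤ 0 →
    (∀ x ∈ pullK mo M a B P, 𝒱.timeOrientation.IsFutureDirected
      (mfderiv 𝓘(ℝ, E4) (𝓡 4) Ψ x ((mo.1 : E4 ≃L[ℝ] E4) (Kerr.timeVector M a (poincareInv mo.1 mo.2 x.1))))) →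
    -- boundary behaviour
    ContinuousOn Ψ (pullK mo M a B (P ∪ slabK M a ∪ (roofK M a hM ∩ {y | Kerr.radius a y.1 ≤ ρ}))) →
    (∀ x ∈ pullK mo M a B (slabK M a), Ψ x = Φ₀ x) →
    Ψ '' pullK mo M a B (roofK M a hM ∩ {y | Kerr.radius a y.1 ≤ ρ}) ⊆
      frontier (𝒱.metric.causalFuture 𝒱.timeOrientation C) →
    ∀ x ∈ pullK mo M a B P,
      𝒱.metric.causalPast 𝒱.timeOrientation {Ψ x} ∩ 𝒱.metric.chronologicalFuture 𝒱.timeOrientation C ⊆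
        Ψ '' pullK mo M a B P

/-- **Chart-gluing lemma** (step (D): exact charts agreeing on an open set agree on the connected
overlap).  Two exact charts `Ψ₁`, `Ψ₂` of the collar background on the pull-backs of open
Kerr-side sets `U₁`, `U₂`, with `U₁ ∩ U₂` CONNECTED, which agree on the pull-back of a nonempty
open `A ⊆ U₁ ∩ U₂`, agree on the pull-back of `U₁ ∩ U₂`.  Paper proof: an exact chart is an
isometric immersion of `(pullK U, g_{Kerr,Λ,c})` into `𝒱` (deviation `0` ⇒ `Ψ^* g = g_B` with
`g_B` nondegenerate ⇒ `dΨ` injective); two isometric immersions agreeing on an open set have the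
same 1-jet at a point, hence agree on the connected domain — the tree's
`PseudoRiemannianMetric.IsIsometricImmersion.eq_of_oneJet_eq` (O'Neill 1983, Prop. 3.62;
Sbierski 2016, §3.1).  MISSING only the packaging of the boosted Kerr form on `B.domain` as a
`PseudoRiemannianMetric` (cf. `KerrSchildChartCovariance`). (ref: ONeill1983, Ch. 3, Prop. 3.62)
Route-posited statement; nothing is asserted. [conjecture] [folklore] -/
def ExactChartGluing : Prop :=
  ∀ [Kerr.Facts] (𝒮 : Spacetime.{0} 4) (M a : ℝ) (mo : lorentzGroup × E4) (B : ModelBackground)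
    (Ψ₁ Ψ₂ : B.domain → 𝒮.carrier) (U₁ U₂ A : Set (Kerr.region a M)),
    0 < M → |a| < M →
    B = starBackground mo.1 mo.2 M a (fun x => Kerr.radius a (poincareInv mo.1 mo.2 x)) →
    IsOpen U₁ → IsOpen U₂ → IsConnected (U₁ ∩ U₂) → IsOpen A → A.Nonempty → A ⊆ U₁ ∩ U₂ →
    ContMDiffOn 𝓘(ℝ, E4) (𝓡 4) ∞ Ψ₁ (pullK mo M a B U₁) →
    supCkENorm (Subtype.val '' pullK mo M a B U₁) 0 (𝒮.deviationExtend B Ψ₁) ≤ 0 →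
    ContMDiffOn 𝓘(ℝ, E4) (𝓡 4) ∞ Ψ₂ (pullK mo M a B U₂) →
    supCkENorm (Subtype.val '' pullK mo M a B U₂) 0 (𝒮.deviationExtend B Ψ₂) ≤ 0 →
    (∀ x ∈ pullK mo M a B A, Ψ₁ x = Ψ₂ x) →
    ∀ x ∈ pullK mo M a B (U₁ ∩ U₂), Ψ₁ x = Ψ₂ x

/-- **MARCHING LEMMA** (the honest content of the corrected F5): under the hypotheses of
`RoofDevelopmentExtensionCollar`, for every `T₀` there is an exact chart of the collar background
on the pull-back of the WHOLE slab of the open causal future below `T₀`,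
`J⁺_K(slab)° ∩ {t* < T₀}`, with image in `J⁺(C)`.  Paper proof (report §4): choose `ρ'` beyond
the `η`-light-cone reach of the slab at time `T₀ + 1` (speed limit, §2) and the boundary-collar
chart `(O, Ψ_E)` for `ρ'`; let `δ₀ > 0` be a Lebesgue number (`N_{δ₀}(roof portion) ∩ W ⊆ O`);
march in steps `h ≍ δ₀`: at level `τ` the slice piece `Σ_τ = {t* = τ} ∩ (W − (h/2) e₀)` lies, with
a neighbourhood, in the current chart domain `U_τ ⊇ W ∩ {t* ≤ τ}` (a past set of `W`); its image
is ACAUSAL in `𝒱` (`ExactChartPastSet`) and carries the `τ`-translate of `Kerr.data`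
(`Kerr.dataEmbedding`, `KerrSchildTimeTranslation`, `HypersurfaceNaturality`); the Kerr KITE over
`Σ_τ` (erosion at unit `η`-speed of the shifted slice, vertical inner wall `{r = M}` justified by
`strictAntiOn_radius`, Cauchy by the clock argument of `SwallowTheDatum.KerrShieldedSettles.stub_collarCauchy`)
is a vacuum Cauchy development of that datum (`Kerr.isRicciFlat_holds`), realised inside the
MAXIMAL `𝒱` over `Ψ_τ|Σ_τ` by
`CaptureSufficesC2.Sketch.stub_hypersurfaceMGHDRealised_of_choquetBruhatGeroch` (conditional on
`choquetBruhat_geroch_exists_mghd_cauchy`) and the maximality of the realised development; glue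
by `ExactChartGluing` (overlap connected by construction), injectivity by `ExactChartPastSet`;
the strip of `W ∩ {τ < t* ≤ τ + h}` not covered by the kite lies within `2h` of
`∂W ⊆ slab ∪ roofK` (`SlabFrontier`; segment argument), hence in `Δ½ ∪ O` (`SlabFutureContainsCylinder`),
already charted; `⌈T₀/h⌉` steps.  Conditional on: `choquetBruhat_geroch_exists_mghd_cauchy`
(named), `SlabFutureContainsCylinder`, `SlabFrontier` (K2c), `ExactChartPastSet`,
`ExactChartGluing`.  Route-posited statement; nothing is asserted. [conjecture] [folklore] -/
def MarchingLemma : Prop :=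
  ∀ [Kerr.Facts] (k' : ℕ), 1 ≤ k' →
    ∀ (X : Type) [TopologicalSpace X] [ChartedSpace E3 X] [IsManifold (𝓡 3) ∞ X]
      [T2Space X] [SecondCountableTopology X] [ConnectedSpace X]
      (D : InitialDataSet (𝓡 3) X) (𝒱 : VacuumCauchyDevelopment D)
      (M a : Fin 1 → ℝ) (p : 𝒱.carrier) (mo : Fin 1 → lorentzGroup × E4)
      (B : Fin 1 → ModelBackground) (Φ : ∀ i, (B i).domain → 𝒱.carrier)
      (hmax : 𝒱.IsMaximal) (hpar : ∀ i, 0 < M i ∧ |a i| < M i),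
    (∃ i, p ∈ Φ i '' (B i).truncTimeSlab (3 * M i) 0) →
    (∀ i, B i = starBackground (mo i).1 (mo i).2 (M i) (a i)
      (fun x => Kerr.radius (a i) (poincareInv (mo i).1 (mo i).2 x))) →
    (∀ i, ContMDiffOn 𝓘(ℝ, E4) (𝓡 4) ∞ (Φ i)
        {x | -1 < (B i).time x.1 ∧ (B i).time x.1 < 1 ∧ (B i).radius x.1 < 3 * M i + 1} ∧
      IsOpenEmbedding ({x | -1 < (B i).time x.1 ∧ (B i).time x.1 < 1 ∧
        (B i).radius x.1 < 3 * M i + 1}.restrict (Φ i))) →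
    (∀ i, 𝒱.toSpacetime.truncDeviationCk (B i) (Φ i) k' (3 * M i) 0 ≤ 0) →
    CollarFutureOriented 𝒱 M mo B Φ →
    collarCore M p B Φ ⊆ range 𝒱.embed →
    (∀ ρ : ℝ, ∃ (O : Set (Kerr.region (a 0) (M 0))) (Ψ : (B 0).domain → 𝒱.carrier),
      IsBoundaryCollarChart (mo 0) (M 0) (a 0) (hpar 0).1 (B 0) (collarCore M p B Φ)
        (𝒱.metric.causalFuture 𝒱.timeOrientation (collarCore M p B Φ)) (Φ 0) ρ O Ψ) →
    ∀ T₀ : ℝ, ∃ Ψ : (B 0).domain → 𝒱.carrier,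
      ContMDiffOn 𝓘(ℝ, E4) (𝓡 4) ∞ Ψ
        (pullK (mo 0) (M 0) (a 0) (B 0) (interior (JK (M 0) (a 0) (hpar 0).1 (slabK (M 0) (a 0))) ∩ {y | y.1 0 < T₀})) ∧
      IsOpenEmbedding ((pullK (mo 0) (M 0) (a 0) (B 0)
        (interior (JK (M 0) (a 0) (hpar 0).1 (slabK (M 0) (a 0))) ∩ {y | y.1 0 < T₀})).restrict Ψ) ∧
      Ψ '' pullK (mo 0) (M 0) (a 0) (B 0) (interior (JK (M 0) (a 0) (hpar 0).1 (slabK (M 0) (a 0))) ∩ {y | y.1 0 < T₀}) ⊆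
        𝒱.metric.causalFuture 𝒱.timeOrientation (collarCore M p B Φ) ∧
      supCkENorm (Subtype.val '' pullK (mo 0) (M 0) (a 0) (B 0)
        (interior (JK (M 0) (a 0) (hpar 0).1 (slabK (M 0) (a 0))) ∩ {y | y.1 0 < T₀})) 0
        (𝒱.toSpacetime.deviationExtend (B 0) Ψ) ≤ 0

/-- **The corrected F5 follows from the marching lemma** (checked reduction: restrict the chart on
`J⁺_K(slab)° ∩ {t* < T₀}` to its open sub-region `truncFutureK ρ T₀`; `exactOn_pullK_mono` with
the openness of `truncFutureK`). -/
theorem roofDevelopmentExtensionCollar_of_marching (hm : MarchingLemma) :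
    RoofDevelopmentExtensionCollar := by
  intro _ k' hk' X _ _ _ _ _ _ D 𝒱 M a p mo B Φ hmax hpar hp hB hΦ hdev hor hCX hcoll ρ T₀
  obtain ⟨Ψ, hs, he, hJ, hd⟩ := hm k' hk' X D 𝒱 M a p mo B Φ hmax hpar hp hB hΦ hdev hor hCX hcoll T₀
  exact ⟨Ψ, exactOn_pullK_mono (hB 0) hs he hJ hd (truncFutureK_subset (M 0) (a 0) (hpar 0).1 ρ T₀)
    (isOpen_truncFutureK (M 0) (a 0) (hpar 0).1 ρ T₀)⟩

end Marching


end K2Route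

/-- **Registered sub-goal of the line** (`stub_roofDevelopmentExtensionCollarOfMarching`): closed form of the
checked reduction of the corrected F5 to the marching lemma. [conjecture] [folklore] -/
theorem stub_roofDevelopmentExtensionCollarOfMarching : K2Route.MarchingLemma → K2Route.RoofDevelopmentExtensionCollar :=
  fun hm ↦ K2Route.roofDevelopmentExtensionCollar_of_marching hm

end Summit.FinalStateConjecture.FinalStateConjecture.Theorems.BondiBartnikRigidity.DirectMethod

end
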